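import Literature.NumberTheory.Sieve.FriedlanderIwaniecPrimes
import HarnessLib

/-!
# Friedlander–Iwaniec, *The polynomial `X² + Y⁴` captures its primes*: the bilinear form `B*(M, N)` of (4.20)

Family `parity`, statement parity.S17 (`setOf_prime_sq_add_pow_four_infinite`). Source: J. Friedlander,
H. Iwaniec, Ann. of Math. (2) 148 (1998), 945–1040 [FriedlanderIwaniecAnnals1998], §4 "The bilinear
form in the sieve: Refinements", (4.9)–(4.23), with the parameter bookkeeping of §18 "Proof of main
theorem" ((4.11), (4.15), (4.16), (5.11), (5.23), (5.24), (9.12), (10.11), (10.12)).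

Proposition 4.1 (`FriedlanderIwaniec1998_prop41`, the bilinear-form hypothesis (2.11) of the
asymptotic sieve for `a_n = #{(a, c) ∈ ℤ² : a² + c⁴ = n}`, "the heart of the problem", §§4–26) is
reduced in §4 to a bound for smoothed, dyadically localised bilinear forms. After removing the `n`
with `τ(n) > τ` ((4.9)–(4.11)), attaching a `C²` partition function `p` supported on a short segment
(4.12) `N' < n ≤ (1+θ)N'`, `N < N' < 2N`, with (4.14) `p^{(j)} ≪ (θN)^{-j}` (`j = 0, 1, 2`),
(4.15) `θ = (log x)^{-A'}`, and splitting `m` dyadically (4.18) `M < m ≤ 2M`, FI arrive at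

  (4.20) `B*(M, N) = Σ_{(m, n) = 1} α(m) β(n) a_{mn}`,

"where we allow `α(m)` to be any complex numbers supported on (4.18) with `|α(m)| ≤ 1`, while `β(n)`
are given by (4.13)" `β(n) = p(n) μ(n) Σ_{c ∣ n, c ≤ C} μ(c)`, the conditions (4.21) `(n, Π) = 1`
(`Π` = the product of the primes below `P`) and (4.22) `τ(n) ≤ τ` being regarded "as restrictions on
the support of `β(n)`"; and "It now suffices to show that for every `N` satisfying (4.6) and `MN`
satisfying (4.19) we have

  (4.23) `B*(M, N) ≪ ϑ θ (MN)^{3/4} (log MN)^4`",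

`ϑ = (log x)^{-A}` (4.16). The parameters are fixed only in §18: "we may for example take
`A' = 2A + 2^20`" ((10.12) `A' ≥ 2A + 2^20`) and `τ` a power of `log x`, at least `(log x)^{A+124}`
((4.11); (10.11) asks `τ ≥ (log x)^{2A+2^20}`), "If we take `B` sufficiently large we then ensure the
remaining conditions (5.11) and (9.12)". The proof of (4.23) occupies §§5–26.

This file fixes the objects `β(n)` and `B*(M, N)`. The sequel
`FriedlanderIwaniecPrimesBilinearReduction` PROVES Proposition 4.1 from (4.23) (the content of §4):
there (4.23) is the explicit HYPOTHESIS `h` of `FriedlanderIwaniec1998_prop41_of_bilinear423`, in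
the shape `BilinBoundAt` (that file), with the quantifier structure recorded below.

## (4.23) is a hypothesis, not a vendored fact (D-0026 review, 2026-08-15)

An earlier version of this file vendored (4.23) as a closed named fact
`FriedlanderIwaniec1998_bilinear423`. It was merged back into the hypothesis of the §4 reduction:
(4.23) is Friedlander–Iwaniec's Theorem 1 minus the elementary §§2–4 — its proof is §§5–26 of the
source (Gaussian reformulation and Cauchy (§5), lattice points in the biquadratic ellipse under a
congruence (§§6–9), mean-value theorems for Jacobi-twisted sums (§§11–14), a Siegel–Walfisz theorem
for Hecke `L`-functions of `ℚ(i)` with Grössencharaktere (§16), Jacobi–Kubota symbols and sums of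
quadratic eigenvalues (§§17–26)) — so it is a waypoint inside the proof of Proposition 4.1, not a
distinct, separately citable result, and as a closed `def` it double-counted the one theorem that
the tree cites as `FriedlanderIwaniec1998_prop41` (Proposition 4.1 as printed), which remains the
single named fact of the tree for FI §§4–26.

## Quantifier structure of the hypothesis (read before supplying or using it)

`∀ η A > 0, ∃ A' ≥ 2A + 2^20, ∃ t ≥ A + 124, ∃ B > 0, ∃ K > 0`, for all large `x`, all `P` in
(4.4) `(log log x)² ≤ log P ≤ (log x)(log log x)⁻²`, all `N` in (4.6) `x^{1/4+η} < N < x^{1/2}(log x)^{-B}`,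
all `C` with `1 ≤ C ≤ N^{1-η}`, all real `M` with `x (log x)^{-2A-8} < MN < x`, all `N'` with
`N < N' < 2N`, all `C²` functions `p` vanishing off `(N', (1+θ)N']` with `|p| ≤ 1`, `|p'| ≤ (θN)⁻¹`,
`|p''| ≤ (θN)⁻²`, and all `α : ℕ → ℂ` with `|α(m)| ≤ 1`:
`‖B*(M, N)‖ ≤ K ϑ θ (MN)^{3/4} (log MN)^4`, where `ϑ = (log x)^{-A}`, `θ = (log x)^{-A'}`,
`τ = (log x)^t`.

* `A'`, `t`, `B`, `K` are existential because the source fixes them only "for example" (§18) and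
  "sufficiently large in terms of `η` and `A`" (Proposition 4.1); any admissible choice serves the
  reduction. The printed choices `A' = 2A + 2^20`, `τ ∈ {(log x)^{A+2^20}, (log x)^{2A+2^20}}` are
  instances. The normalisation of (4.14) to implied constant `1` is harmless (`B*` is linear in `p`).
* The range of `M`. (4.19) prints `ϑx < MN < x`, the terms with `m ≤ ϑ x N⁻¹` being "absorbed by the
  bound (4.17)". Counted with (4.2), those terms contribute `≍ ϑ^{3/4} θ A(x) (log x)^{O(1)}` to each
  smoothed form, which is NOT `O(ϑ θ A(x)(log x)^4)` once `A` is large ((4.7) needs `A = 2^26 + 4`);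
  the reduction therefore needs (4.23) down to `MN > x(log x)^{-2A-8}`. This is within what §§5–18
  prove: the lower bound for `MN` enters there only through conditions met by taking `B` large —
  (5.11) `N ≤ ϑθ√(MN)`, (9.12) (via `M/N ≥ ϑ(log x)^{2B}`), and "`M ≥ N` since we may require
  `B ≥ 2A`" (§4) — exactly as the printed `B = B(η, A)` absorbs (4.19).
* `log MN` versus `log x`: as printed (`MN < x`, so this is the stronger form).

## Contents

* `FriedlanderIwaniecPrimes.fiBeta p C P τ n` — the coefficients (4.13) with the support conventions
  (4.21)–(4.22): `p(n) μ(n) γ(n, C)` if every prime factor of `n` is `≥ P` and `τ(n) ≤ τ`, else `0`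
  (`γ(n, C) = Σ_{c ∣ n, c ≤ C} μ(c)` is the tree's `SieveSequence.fiGamma`);
* `FriedlanderIwaniecPrimes.fiBilinearStar α p M N' θ C P τ` — (4.20), the sum over `M < m ≤ 2M`,
  `N' < n ≤ (1+θ)N'`, `(m, n) = 1` of `α(m) β(n) a_{mn}` (complex valued: `α` is complex);
* the trivial bounds `abs_fiBeta_le`, `norm_fiBilinearStar_le`.

## References

* J. Friedlander, H. Iwaniec, *The polynomial `X² + Y⁴` captures its primes*, Ann. of Math. (2)
  148 (1998), 945–1040: §4 (4.3)–(4.23), §5 (5.11), (5.23)–(5.24), §9 (9.12), §10 (10.11)–(10.12),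
  §18. [FriedlanderIwaniecAnnals1998]

## Tree

`fiRepCount` (`a_n`), `SieveSequence.fiBilinearPi` (`B(x; N)` of (4.3)), `FriedlanderIwaniec1998_prop41`
(`FriedlanderIwaniecPrimes`); `SieveSequence.fiGamma` (`AsymptoticSieveForPrimes`). Mathlib: `ContDiff`,
`deriv`, `ArithmeticFunction.moebius`, `ArithmeticFunction.sigma`.
-/

noncomputable section

open Filter Finset Real
open scoped ArithmeticFunction.Moebius ArithmeticFunction.sigma

namespace Literature.NumberTheory.Sieve

namespace FriedlanderIwaniecPrimes

/-- FI (4.13) with the support conventions (4.21)–(4.22): the coefficients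
`β(n) = p(n) μ(n) Σ_{c ∣ n, c ≤ C} μ(c) = p(n) μ(n) γ(n, C)`, set to `0` unless `(n, Π) = 1` — every
prime factor of `n` is `≥ P`, `Π` being the product of the primes below `P` ((2.15); §4 prints
"`p ≤ P`"), the convention of `SieveSequence.fiBilinearPi` — and (4.22) = (4.9) `τ(n) ≤ τ`.
[cite: FriedlanderIwaniecAnnals1998, (4.13) with (4.21)-(4.22)] -/
def fiBeta (p : ℝ → ℝ) (C P τ : ℝ) (n : ℕ) : ℝ :=
  if (∀ q ∈ n.primeFactors, P ≤ (q : ℝ)) ∧ ((σ 0 n : ℕ) : ℝ) ≤ τ then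
    p n * (μ n : ℝ) * (SieveSequence.fiGamma C n : ℝ)
  else 0

/-- `fiBeta` unfolded. [cite: FriedlanderIwaniecAnnals1998, (4.13) with (4.21)-(4.22)] -/
theorem fiBeta_def (p : ℝ → ℝ) (C P τ : ℝ) (n : ℕ) :
    fiBeta p C P τ n = if (∀ q ∈ n.primeFactors, P ≤ (q : ℝ)) ∧ ((σ 0 n : ℕ) : ℝ) ≤ τ then
      p n * (μ n : ℝ) * (SieveSequence.fiGamma C n : ℝ) else 0 := rfl

/-- `β(n) = 0` where the partition function vanishes. [folklore] -/
theorem fiBeta_eq_zero_of_apply_eq_zero {p : ℝ → ℝ} {n : ℕ} (hp : p n = 0) (C P τ : ℝ) :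
    fiBeta p C P τ n = 0 := by
  simp [fiBeta, hp]

/-- The trivial bound `|β(n)| ≤ |p(n)| τ(n)` (`|μ(n)| ≤ 1`, `|γ(n, C)| ≤ τ(n)`). [folklore] -/
theorem abs_fiBeta_le (p : ℝ → ℝ) (C P τ : ℝ) (n : ℕ) :
    |fiBeta p C P τ n| ≤ |p n| * (σ 0 n : ℕ) := by
  unfold fiBeta
  split_ifs
  · rw [abs_mul, abs_mul]
    have hμ : |(μ n : ℝ)| ≤ 1 := by exact_mod_cast ArithmeticFunction.abs_moebius_le_one
    have hγ : |(SieveSequence.fiGamma C n : ℝ)| ≤ (σ 0 n : ℕ) := by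
      have h := SieveSequence.abs_fiGamma_le C n
      have h' : ((|SieveSequence.fiGamma C n| : ℤ) : ℝ) ≤ ((σ 0 n : ℕ) : ℤ) := by exact_mod_cast h
      simpa [Int.cast_abs] using h'
    calc |p n| * |(μ n : ℝ)| * |(SieveSequence.fiGamma C n : ℝ)|
        ≤ |p n| * 1 * (σ 0 n : ℕ) := by gcongr
      _ = |p n| * (σ 0 n : ℕ) := by ring
  · simpa using mul_nonneg (abs_nonneg (p n)) (Nat.cast_nonneg (σ 0 n))

/-- FI (4.20): the bilinear form
`B*(M, N) = Σ_{(m, n) = 1} α(m) β(n) a_{mn}`, `α` supported on (4.18) `M < m ≤ 2M`, `β = fiBeta p C P τ`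
supported (through `p`) on the segment (4.12) `N' < n ≤ (1+θ)N'`, `a_{mn} = fiRepCount (mn)` (4.1).
The value is complex because "we allow `α(m)` to be any complex numbers".
[cite: FriedlanderIwaniecAnnals1998, (4.20) with (4.12)-(4.13), (4.18), (4.21)-(4.22)] -/
def fiBilinearStar (α : ℕ → ℂ) (p : ℝ → ℝ) (M N' θ C P τ : ℝ) : ℂ :=
  ∑ m ∈ Ioc ⌊M⌋₊ ⌊2 * M⌋₊,
    ∑ n ∈ (Ioc ⌊N'⌋₊ ⌊(1 + θ) * N'⌋₊).filter (fun n : ℕ => n.Coprime m),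
      α m * ((fiBeta p C P τ n * (fiRepCount (m * n) : ℝ) : ℝ) : ℂ)

/-- `fiBilinearStar` unfolded. [cite: FriedlanderIwaniecAnnals1998, (4.20)] -/
theorem fiBilinearStar_def (α : ℕ → ℂ) (p : ℝ → ℝ) (M N' θ C P τ : ℝ) :
    fiBilinearStar α p M N' θ C P τ = ∑ m ∈ Ioc ⌊M⌋₊ ⌊2 * M⌋₊,
      ∑ n ∈ (Ioc ⌊N'⌋₊ ⌊(1 + θ) * N'⌋₊).filter (fun n : ℕ => n.Coprime m),
        α m * ((fiBeta p C P τ n * (fiRepCount (m * n) : ℝ) : ℝ) : ℂ) := rfl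

/-- The trivial estimate `‖B*(M, N)‖ ≤ Σ_m Σ_n |β(n)| a_{mn}` for `|α| ≤ 1`. [folklore] -/
theorem norm_fiBilinearStar_le {α : ℕ → ℂ} (hα : ∀ m, ‖α m‖ ≤ 1) (p : ℝ → ℝ)
    (M N' θ C P τ : ℝ) :
    ‖fiBilinearStar α p M N' θ C P τ‖ ≤ ∑ m ∈ Ioc ⌊M⌋₊ ⌊2 * M⌋₊,
      ∑ n ∈ (Ioc ⌊N'⌋₊ ⌊(1 + θ) * N'⌋₊).filter (fun n : ℕ => n.Coprime m),
        |fiBeta p C P τ n| * (fiRepCount (m * n) : ℝ) := by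
  unfold fiBilinearStar
  refine (norm_sum_le _ _).trans (Finset.sum_le_sum fun m _ => ?_)
  refine (norm_sum_le _ _).trans (Finset.sum_le_sum fun n _ => ?_)
  have ha : |(fiRepCount (m * n) : ℝ)| = fiRepCount (m * n) := abs_of_nonneg (Nat.cast_nonneg _)
  rw [norm_mul, Complex.norm_real, Real.norm_eq_abs, abs_mul, ha]
  calc ‖α m‖ * (|fiBeta p C P τ n| * (fiRepCount (m * n) : ℝ))
      ≤ 1 * (|fiBeta p C P τ n| * (fiRepCount (m * n) : ℝ)) :=
        mul_le_mul_of_nonneg_right (hα m) (by positivity)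
    _ = _ := one_mul _

end FriedlanderIwaniecPrimes

end Literature.NumberTheory.Sieve
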